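import Summits.MatrixMultiplication.OmegaCensus.STPPDisjointPacking

/-!
# ω-census: the role symmetry of CKSU Def. 5.1 — all six permutations of `(A, B, C)` preserve `IsSTPP`

HONEST FRAMING (pub-omega census; verbatim): lottery ticket; floor = certified bounds/negative ranges.
Census STRUCTURE bookkeeping (question Q7 of the pub-omega cell), not progress on `ω`.

The tree's `IsSTPP A B C` (Cohn–Kleinberg–Szegedy–Umans 2005, Def. 5.1, additive form) quantifies over the words
`(s' − s) + (t' − t) + (u' − u)` with `s' ∈ A i, s ∈ A k`, `t' ∈ B j, t ∈ B i`, `u' ∈ C k, u ∈ C j`.  In an abelian group every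
permutation of the three ROLES maps this family of words onto itself up to sign, a permutation of the index triple
`(i, j, k)` and the exchange of primed and unprimed letters, so the property is invariant under the full symmetric group on
`(A, B, C)`.  The cyclic rotation is already in the tree as `stpp_rotate` (`STPPDisjointPacking.lean`; also
`IsSTPP.rotate` in `Literature/Barriers/…/TricoloredSumFreeBarrier.lean` and the local `STPP222CubeNeg.isSTPP_rotate`),
and the exchange `B ↔ C` locally as `STPP222SqNeg.isSTPP_swapBC` (through `image (x ↦ -x)`, hence with `DecidableEq`);
this file records the REMAINING FOUR non-trivial permutations as direct four-line consequences of the definition (no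
decidability, no images), the `iff` forms of all five, and the existence-with-prescribed-sizes `iff`s in which census
engines use the symmetry, so that they can be cited by name.

USE (pub-omega ENG2, class census of involution-coset `(2,2,2)^K` families in `ℤ/2 × (ℤ/4)³`, 2026-08-28): on the
normal-form quotient data `(β_t, γ_t) = (q(B_t) − q(A_t), q(C_t) − q(A_t)) ∈ (ℤ/2)³ × (ℤ/2)³` of such a family the role
permutations act linearly on the PAIR index — `(A,B,C) ↦ (B,C,A)` gives `(β, γ) ↦ (β + γ, β)`, `(A,B,C) ↦ (A,C,B)` gives
`(β, γ) ↦ (γ, β)` — generating `GL₂(𝔽₂) ≅ S₃`; together with the translations and the diagonal `GL₃(𝔽₂)` this cuts the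
number of symmetry classes of `K = 8` data from `1 017 577` to `172 823` (Burnside), i.e. the SAT census of the cell
`[2,4,4,4]` needs about six times fewer class decisions.  Nothing in this file depends on that application.

References: H. Cohn, R. Kleinberg, B. Szegedy, C. Umans, *Group-theoretic algorithms for matrix multiplication*, FOCS 2005
(arXiv:math/0511460), Def. 5.1.  Seat pub-omega ENG2 (gen 30), 2026-08-28.
-/

open Literature.Computability.AlgebraicComplexity Finset

namespace Summit.MatrixMultiplication.OmegaCensus

variable {G : Type*} [AddCommGroup G] {N : ℕ} {A B C : Fin N → Finset G}

/-- Role permutation `(A, B, C) ↦ (C, A, B)` (inverse rotation) preserves the simultaneous triple product property: the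
word of the rotated family at `(i, j, k)` is the word of the original family at `(j, k, i)`, re-associated.
[cite: CohnKleinbergSzegedyUmans2005, Def. 5.1] -/
theorem isSTPP_roles_CAB (hS : IsSTPP A B C) : IsSTPP C A B := by
  intro i j k s hs s' hs' t ht t' ht' u hu u' hu' h0
  have h0' : (t' - t) + (u' - u) + (s' - s) = 0 := by rw [← h0]; abel
  obtain ⟨hjk, hki, e1, e2, e3⟩ := hS j k i t ht t' ht' u hu u' hu' s hs s' hs' h0'
  exact ⟨(hjk.trans hki).symm, hjk, e3, e1, e2⟩

/-- Role permutation `(A, B, C) ↦ (A, C, B)` (exchange of `B` and `C`) preserves the simultaneous triple product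
property: the word of the new family at `(i, j, k)` is the NEGATIVE of the original word at `(k, j, i)` with primed and
unprimed letters exchanged.  (Same statement as `STPP222SqNeg.isSTPP_swapBC`, here without `DecidableEq`.)
[cite: CohnKleinbergSzegedyUmans2005, Def. 5.1] -/
theorem isSTPP_roles_ACB (hS : IsSTPP A B C) : IsSTPP A C B := by
  intro i j k s hs s' hs' t ht t' ht' u hu u' hu' h0
  have h0' : (s - s') + (u - u') + (t - t') = 0 := by rw [← neg_eq_zero, ← h0]; abel
  obtain ⟨hkj, hji, e1, e2, e3⟩ := hS k j i s' hs' s hs u' hu' u hu t' ht' t ht h0'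
  exact ⟨hji.symm, hkj.symm, e1.symm, e3.symm, e2.symm⟩

/-- Role permutation `(A, B, C) ↦ (C, B, A)` (exchange of `A` and `C`) preserves the simultaneous triple product
property: the word of the new family at `(i, j, k)` is the negative of the original word at `(j, i, k)` with primed and
unprimed letters exchanged. [cite: CohnKleinbergSzegedyUmans2005, Def. 5.1] -/
theorem isSTPP_roles_CBA (hS : IsSTPP A B C) : IsSTPP C B A := by
  intro i j k s hs s' hs' t ht t' ht' u hu u' hu' h0
  have h0' : (u - u') + (t - t') + (s - s') = 0 := by rw [← neg_eq_zero, ← h0]; abel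
  obtain ⟨hji, hik, e1, e2, e3⟩ := hS j i k u' hu' u hu t' ht' t ht s' hs' s hs h0'
  exact ⟨hji.symm, hji.trans hik, e3.symm, e2.symm, e1.symm⟩

/-- Role permutation `(A, B, C) ↦ (B, A, C)` (exchange of `A` and `B`) preserves the simultaneous triple product
property: the word of the new family at `(i, j, k)` is the negative of the original word at `(i, k, j)` with primed and
unprimed letters exchanged. [cite: CohnKleinbergSzegedyUmans2005, Def. 5.1] -/
theorem isSTPP_roles_BAC (hS : IsSTPP A B C) : IsSTPP B A C := by
  intro i j k s hs s' hs' t ht t' ht' u hu u' hu' h0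
  have h0' : (t - t') + (s - s') + (u - u') = 0 := by rw [← neg_eq_zero, ← h0]; abel
  obtain ⟨hik, hkj, e1, e2, e3⟩ := hS i k j t' ht' t ht s' hs' s hs u' hu' u hu h0'
  exact ⟨hik.trans hkj, hkj.symm, e2.symm, e1.symm, e3.symm⟩

/-- `IsSTPP` is invariant under the cyclic rotation of the roles (`iff` form of the tree's `stpp_rotate`; the converse is
the rotation applied twice more). [cite: CohnKleinbergSzegedyUmans2005, Def. 5.1] -/
theorem isSTPP_roles_BCA_iff : IsSTPP B C A ↔ IsSTPP A B C :=
  ⟨fun h => stpp_rotate (stpp_rotate h), stpp_rotate⟩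

/-- `IsSTPP` is invariant under the exchange of the roles `B` and `C` (`iff` form; the exchange is an involution).
[cite: CohnKleinbergSzegedyUmans2005, Def. 5.1] -/
theorem isSTPP_roles_ACB_iff : IsSTPP A C B ↔ IsSTPP A B C :=
  ⟨isSTPP_roles_ACB, isSTPP_roles_ACB⟩

/-- `IsSTPP` is invariant under the exchange of the roles `A` and `B` (`iff` form; the exchange is an involution).
[cite: CohnKleinbergSzegedyUmans2005, Def. 5.1] -/
theorem isSTPP_roles_BAC_iff : IsSTPP B A C ↔ IsSTPP A B C :=
  ⟨isSTPP_roles_BAC, isSTPP_roles_BAC⟩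

/-- `IsSTPP` is invariant under the exchange of the roles `A` and `C` (`iff` form; the exchange is an involution).
[cite: CohnKleinbergSzegedyUmans2005, Def. 5.1] -/
theorem isSTPP_roles_CBA_iff : IsSTPP C B A ↔ IsSTPP A B C :=
  ⟨isSTPP_roles_CBA, isSTPP_roles_CBA⟩

/-- Existence of an STPP family with prescribed set sizes is invariant under every permutation of the roles: a family with
`|A t| = a t`, `|B t| = b t`, `|C t| = c t` exists iff one with the sizes read in the order `(b, c, a)` exists (rotation) —
the form in which census engines use the symmetry (a pattern and its role-permuted patterns are realised by the same
groups). [cite: CohnKleinbergSzegedyUmans2005, Def. 5.1] -/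
theorem exists_isSTPP_sizes_rotate_iff (a b c : Fin N → ℕ) :
    (∃ A B C : Fin N → Finset G, IsSTPP A B C ∧ ∀ t, (A t).card = a t ∧ (B t).card = b t ∧ (C t).card = c t) ↔
      ∃ A B C : Fin N → Finset G, IsSTPP A B C ∧ ∀ t, (A t).card = b t ∧ (B t).card = c t ∧ (C t).card = a t := by
  constructor
  · rintro ⟨A, B, C, hS, hc⟩
    exact ⟨B, C, A, stpp_rotate hS, fun t => ⟨(hc t).2.1, (hc t).2.2, (hc t).1⟩⟩
  · rintro ⟨A, B, C, hS, hc⟩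
    exact ⟨C, A, B, isSTPP_roles_CAB hS, fun t => ⟨(hc t).2.2, (hc t).1, (hc t).2.1⟩⟩

/-- Existence of an STPP family with prescribed set sizes is invariant under the exchange of the last two roles: sizes
`(a, b, c)` are realisable iff `(a, c, b)` are. [cite: CohnKleinbergSzegedyUmans2005, Def. 5.1] -/
theorem exists_isSTPP_sizes_swap_iff (a b c : Fin N → ℕ) :
    (∃ A B C : Fin N → Finset G, IsSTPP A B C ∧ ∀ t, (A t).card = a t ∧ (B t).card = b t ∧ (C t).card = c t) ↔
      ∃ A B C : Fin N → Finset G, IsSTPP A B C ∧ ∀ t, (A t).card = a t ∧ (B t).card = c t ∧ (C t).card = b t := by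
  constructor
  · rintro ⟨A, B, C, hS, hc⟩
    exact ⟨A, C, B, isSTPP_roles_ACB hS, fun t => ⟨(hc t).1, (hc t).2.2, (hc t).2.1⟩⟩
  · rintro ⟨A, B, C, hS, hc⟩
    exact ⟨A, C, B, isSTPP_roles_ACB hS, fun t => ⟨(hc t).1, (hc t).2.2, (hc t).2.1⟩⟩

end Summit.MatrixMultiplication.OmegaCensus
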